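import Summits.QuantumFields.GaugeBoot.PolynomialObservables
import HarnessLib

/-!
# Archimedean bounds: finitely many PSD constraints already bound every polynomial expectation value (gauge-boot, L1 supplement)

HONEST FRAMING (cell `pub-gaugeboot`, page 1 of every file): the venture produces certified bounds
on lattice expectations at stated coupling, gauge group, dimension and torus size; NOT a mass gap,
NOT a continuum limit, NOT a string tension; NOT Yang–Mills-summit-bearing (barriers
`FixedCouplingUltralocality`, `PerturbativeInvisibility`). Structural; it certifies no number.

## Content (compactness of the truncated bootstrap's feasible region)

For a faithful unitary `r : LatticeRep G` and configurations `ι → G`, the link variables are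
unitary, so each ROW of `ρ(U_e)` has unit norm: `Σ_b (Re ρ(U_e)_{ab})² + (Im ρ(U_e)_{ab})² = 1` as
an identity of polynomial observables (`sum_sq_entries_eq_one`). Consequently a LINEAR functional
`φ` (no positivity on all squares, no continuity) satisfies

* `exists_finset_sq_le` — for every word `m` (product of generators) there is a FINITE set `s` of
  polynomials such that `0 ≤ φ (v v)` for `v ∈ s` implies `φ (m m) ≤ φ 1` (induction over the
  word: `φ(x² y²) ≤ φ(x²) ≤ φ(1)` using the functional `f ↦ φ(x² f)`);
* `exists_finset_abs_le_one` — plus `φ 1 = 1` and two more squares `(1 ± m)²`: `|φ m| ≤ 1`;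
* ★★ `exists_finset_abs_le` — for every polynomial observable `a` there are `C` and a finite set
  `s` of polynomials with: `φ 1 = 1` and `0 ≤ φ (v v)` (`v ∈ s`) imply `|φ a| ≤ C`.

So every sufficiently high TRUNCATION of the bootstrap (one whose PSD constraints contain the
finitely many squares `s`) confines the value of `a` to `[-C, C]`: the feasible regions are
eventually bounded, coordinate by coordinate — the compactness behind the convergence theorem of
`BootstrapConvergence.lean`.

References: P. Anderson, M. Kruczenski, Nucl. Phys. B 921 (2017) §2 (unitarity constraints);
V. Kazakov, Z. Zheng, arXiv:2203.11360 §2; Berg–Christensen–Ressel (1984) §4.5 Lemma 5.2/5.3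
(the archimedean mechanism). Folklore.
-/

noncomputable section

open scoped Matrix ComplexConjugate
open Literature.MathematicalPhysics.QuantumFieldTheory (LatticeRep)

namespace Summit.QuantumFields.GaugeBoot

variable {ι : Type*} {G : Type*} [Group G] [TopologicalSpace G] (r : LatticeRep G)

/-! ## Row unitarity as a polynomial identity -/

/-- **Unit rows**: `Σ_b (Re ρ(U_e)_{ab})² + (Im ρ(U_e)_{ab})² = 1` in `C(ι → G, ℝ)` (`ρ(U_e)` is
unitary, `ρ ρᴴ = 1`). [folklore] -/
theorem sum_sq_entries_eq_one (e : ι) (a : Fin r.N) :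
    ∑ b, (reEntry r e a b * reEntry r e a b + imEntry r e a b * imEntry r e a b) =
      (1 : C(ι → G, ℝ)) := by
  ext U
  have hU := Matrix.mem_unitaryGroup_iff.1 (r.mem_unitary (U e))
  have h := congrArg (fun M : Matrix (Fin r.N) (Fin r.N) ℂ => (M a a).re) hU
  simp only [Matrix.mul_apply, Matrix.star_apply, Complex.star_def, Complex.mul_conj,
    Complex.re_sum, Complex.ofReal_re, Complex.normSq_apply, Matrix.one_apply_eq,
    Complex.one_re] at h
  simpa [ContinuousMap.coe_sum, Finset.sum_apply] using h

/-- Words in the generators are polynomial observables. -/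
theorem mem_polyAlgebra_of_mem_closure {m : C(ι → G, ℝ)}
    (hm : m ∈ Submonoid.closure (entryGens (ι := ι) r)) : m ∈ polyAlgebra (ι := ι) r :=
  (Submonoid.closure_le (S := (polyAlgebra (ι := ι) r).toSubmonoid)).2
    (fun _ hx => Algebra.subset_adjoin hx) hm

/-! ## Squares of words are dominated by `φ 1` -/

/-- ★ **`φ (m m) ≤ φ 1` from finitely many squares.** For every word `m` in the generators there is
a finite set `s` of polynomial observables such that every linear functional which is non-negative
on the squares of `s` satisfies `φ (m m) ≤ φ 1`. [folklore] -/
theorem exists_finset_sq_le {m : C(ι → G, ℝ)} (hm : m ∈ Submonoid.closure (entryGens (ι := ι) r)) :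
    ∃ s : Finset C(ι → G, ℝ), (∀ v ∈ s, v ∈ polyAlgebra (ι := ι) r) ∧
      ∀ φ : C(ι → G, ℝ) →ₗ[ℝ] ℝ, (∀ v ∈ s, 0 ≤ φ (v * v)) → φ (m * m) ≤ φ 1 := by
  classical
  induction hm using Submonoid.closure_induction with
  | mem x hx =>
    rcases hx with ⟨⟨e, a, b⟩, rfl⟩ | ⟨⟨e, a, b⟩, rfl⟩
    · refine ⟨Finset.univ.image (fun b' => reEntry r e a b') ∪
        Finset.univ.image (fun b' => imEntry r e a b'), fun v hv => ?_, fun φ hφ => ?_⟩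
      · rcases Finset.mem_union.1 hv with hv | hv
        · obtain ⟨b', -, rfl⟩ := Finset.mem_image.1 hv
          exact reEntry_mem r e a b'
        · obtain ⟨b', -, rfl⟩ := Finset.mem_image.1 hv
          exact imEntry_mem r e a b'
      · have hre : ∀ b', 0 ≤ φ (reEntry r e a b' * reEntry r e a b') := fun b' =>
          hφ _ (Finset.mem_union_left _ (Finset.mem_image.2 ⟨b', Finset.mem_univ _, rfl⟩))
        have him : ∀ b', 0 ≤ φ (imEntry r e a b' * imEntry r e a b') := fun b' =>
          hφ _ (Finset.mem_union_right _ (Finset.mem_image.2 ⟨b', Finset.mem_univ _, rfl⟩))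
        have hnn : ∀ b' ∈ (Finset.univ : Finset (Fin r.N)),
            0 ≤ φ (reEntry r e a b' * reEntry r e a b' + imEntry r e a b' * imEntry r e a b') :=
          fun b' _ => by rw [map_add]; exact add_nonneg (hre b') (him b')
        rw [← sum_sq_entries_eq_one r e a, map_sum]
        calc φ (reEntry r e a b * reEntry r e a b)
            ≤ φ (reEntry r e a b * reEntry r e a b + imEntry r e a b * imEntry r e a b) := by
              rw [map_add]; exact le_add_of_nonneg_right (him b)
          _ ≤ ∑ b', φ (reEntry r e a b' * reEntry r e a b' + imEntry r e a b' * imEntry r e a b') :=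
              Finset.single_le_sum hnn (Finset.mem_univ b)
    · refine ⟨Finset.univ.image (fun b' => reEntry r e a b') ∪
        Finset.univ.image (fun b' => imEntry r e a b'), fun v hv => ?_, fun φ hφ => ?_⟩
      · rcases Finset.mem_union.1 hv with hv | hv
        · obtain ⟨b', -, rfl⟩ := Finset.mem_image.1 hv
          exact reEntry_mem r e a b'
        · obtain ⟨b', -, rfl⟩ := Finset.mem_image.1 hv
          exact imEntry_mem r e a b'
      · have hre : ∀ b', 0 ≤ φ (reEntry r e a b' * reEntry r e a b') := fun b' =>
          hφ _ (Finset.mem_union_left _ (Finset.mem_image.2 ⟨b', Finset.mem_univ _, rfl⟩))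
        have him : ∀ b', 0 ≤ φ (imEntry r e a b' * imEntry r e a b') := fun b' =>
          hφ _ (Finset.mem_union_right _ (Finset.mem_image.2 ⟨b', Finset.mem_univ _, rfl⟩))
        have hnn : ∀ b' ∈ (Finset.univ : Finset (Fin r.N)),
            0 ≤ φ (reEntry r e a b' * reEntry r e a b' + imEntry r e a b' * imEntry r e a b') :=
          fun b' _ => by rw [map_add]; exact add_nonneg (hre b') (him b')
        rw [← sum_sq_entries_eq_one r e a, map_sum]
        calc φ (imEntry r e a b * imEntry r e a b)
            ≤ φ (reEntry r e a b * reEntry r e a b + imEntry r e a b * imEntry r e a b) := by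
              rw [map_add]; exact le_add_of_nonneg_left (hre b)
          _ ≤ ∑ b', φ (reEntry r e a b' * reEntry r e a b' + imEntry r e a b' * imEntry r e a b') :=
              Finset.single_le_sum hnn (Finset.mem_univ b)
  | one => exact ⟨∅, by simp, fun φ _ => by rw [one_mul]⟩
  | mul x y hx _ ihx ihy =>
    obtain ⟨s₁, hs₁A, hs₁⟩ := ihx
    obtain ⟨s₂, hs₂A, hs₂⟩ := ihy
    have hxA : x ∈ polyAlgebra (ι := ι) r := mem_polyAlgebra_of_mem_closure r hx
    refine ⟨s₁ ∪ s₂.image (fun v => x * v), fun v hv => ?_, fun φ hφ => ?_⟩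
    · rcases Finset.mem_union.1 hv with hv | hv
      · exact hs₁A v hv
      · obtain ⟨w, hw, rfl⟩ := Finset.mem_image.1 hv
        exact (polyAlgebra (ι := ι) r).mul_mem hxA (hs₂A w hw)
    · -- the functional `f ↦ φ (x x f)` is non-negative on the squares of `s₂`
      set ψ : C(ι → G, ℝ) →ₗ[ℝ] ℝ := φ ∘ₗ LinearMap.mulLeft ℝ (x * x) with hψ
      have hψv : ∀ v ∈ s₂, 0 ≤ ψ (v * v) := fun v hv => by
        have h := hφ (x * v) (Finset.mem_union_right _ (Finset.mem_image.2 ⟨v, hv, rfl⟩))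
        have e1 : x * v * (x * v) = x * (x * (v * v)) := by ring
        rw [e1] at h
        simpa [hψ, mul_assoc] using h
      have h1 : φ (x * (x * (y * y))) ≤ φ (x * x) := by
        simpa [hψ, mul_assoc] using hs₂ ψ hψv
      have h2 : φ (x * x) ≤ φ 1 := hs₁ φ fun v hv => hφ v (Finset.mem_union_left _ hv)
      have e2 : x * y * (x * y) = x * (x * (y * y)) := by ring
      calc φ (x * y * (x * y)) = φ (x * (x * (y * y))) := by rw [e2]
        _ ≤ φ (x * x) := h1
        _ ≤ φ 1 := h2

/-- ★ **`|φ m| ≤ 1` for words**, from normalisation and finitely many squares. [folklore] -/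
theorem exists_finset_abs_le_one {m : C(ι → G, ℝ)}
    (hm : m ∈ Submonoid.closure (entryGens (ι := ι) r)) :
    ∃ s : Finset C(ι → G, ℝ), (∀ v ∈ s, v ∈ polyAlgebra (ι := ι) r) ∧
      ∀ φ : C(ι → G, ℝ) →ₗ[ℝ] ℝ, φ 1 = 1 → (∀ v ∈ s, 0 ≤ φ (v * v)) → |φ m| ≤ 1 := by
  classical
  obtain ⟨s, hsA, hs⟩ := exists_finset_sq_le r hm
  have hmA : m ∈ polyAlgebra (ι := ι) r := mem_polyAlgebra_of_mem_closure r hm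
  refine ⟨s ∪ {1 + m, 1 - m}, fun v hv => ?_, fun φ h1 hφ => ?_⟩
  · rcases Finset.mem_union.1 hv with hv | hv
    · exact hsA v hv
    · rcases Finset.mem_insert.1 hv with rfl | hv
      · exact (polyAlgebra (ι := ι) r).add_mem (polyAlgebra (ι := ι) r).one_mem hmA
      · rw [Finset.mem_singleton.1 hv]
        exact (polyAlgebra (ι := ι) r).sub_mem (polyAlgebra (ι := ι) r).one_mem hmA
  · have hmm : φ (m * m) ≤ 1 := h1 ▸ hs φ fun v hv => hφ v (Finset.mem_union_left _ hv)
    have hp : 0 ≤ φ ((1 + m) * (1 + m)) :=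
      hφ _ (Finset.mem_union_right _ (Finset.mem_insert_self _ _))
    have hn : 0 ≤ φ ((1 - m) * (1 - m)) :=
      hφ _ (Finset.mem_union_right _ (Finset.mem_insert_of_mem (Finset.mem_singleton_self _)))
    have ep : (1 + m) * (1 + m) = 1 + 2 • m + m * m := by ring
    have en : (1 - m) * (1 - m) = 1 - 2 • m + m * m := by ring
    rw [ep, map_add, map_add, map_nsmul, h1] at hp
    rw [en, map_add, map_sub, map_nsmul, h1] at hn
    rw [abs_le]
    constructor
    · have : (0 : ℝ) ≤ 1 + 2 • φ m + φ (m * m) := hp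
      rw [nsmul_eq_mul] at this
      push_cast at this
      linarith
    · have : (0 : ℝ) ≤ 1 - 2 • φ m + φ (m * m) := hn
      rw [nsmul_eq_mul] at this
      push_cast at this
      linarith

/-- ★★ **Every polynomial observable is bounded by finitely many PSD constraints.** For every
`a ∈ polyAlgebra r` there are `C` and a finite set `s` of polynomial observables such that every
linear functional with `φ 1 = 1` and `0 ≤ φ (v v)` for `v ∈ s` satisfies `|φ a| ≤ C` (write `a` as a
linear combination of words; `C = Σ |coefficients|`). [folklore] -/
theorem exists_finset_abs_le {a : C(ι → G, ℝ)} (ha : a ∈ polyAlgebra (ι := ι) r) :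
    ∃ (C : ℝ) (s : Finset C(ι → G, ℝ)), (∀ v ∈ s, v ∈ polyAlgebra (ι := ι) r) ∧
      ∀ φ : C(ι → G, ℝ) →ₗ[ℝ] ℝ, φ 1 = 1 → (∀ v ∈ s, 0 ≤ φ (v * v)) → |φ a| ≤ C := by
  classical
  have ha' : a ∈ Submodule.span ℝ (Submonoid.closure (entryGens (ι := ι) r) : Set C(ι → G, ℝ)) := by
    have h := Algebra.adjoin_eq_span ℝ (entryGens (ι := ι) r)
    rw [← Subalgebra.mem_toSubmodule, polyAlgebra, h] at ha
    exact ha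
  obtain ⟨n, c, g, hsum⟩ := Submodule.mem_span_set'.1 ha'
  choose s hsA hs using fun j => exists_finset_abs_le_one r (g j).2
  refine ⟨∑ j, |c j|, Finset.univ.biUnion s, fun v hv => ?_, fun φ h1 hφ => ?_⟩
  · obtain ⟨j, -, hj⟩ := Finset.mem_biUnion.1 hv
    exact hsA j v hj
  · rw [← hsum, map_sum]
    simp only [map_smul, smul_eq_mul]
    refine (Finset.abs_sum_le_sum_abs _ _).trans (Finset.sum_le_sum fun j _ => ?_)
    rw [abs_mul]
    exact mul_le_of_le_one_right (abs_nonneg _)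
      (hs j φ h1 fun v hv => hφ v (Finset.mem_biUnion.2 ⟨j, Finset.mem_univ _, hv⟩))

end Summit.QuantumFields.GaugeBoot

end
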